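import Literature.Analysis.FunctionSpaces.PositiveKernelOperator
import Literature.MathematicalPhysics.QuantumManyBody.GroundStateFeynmanKacSpectral
import HarnessLib

/-!
# Positive eigenfunctions of symmetric positive continuous kernels (Jentzsch's theorem)

Topic `Literature/Analysis/FunctionSpaces`; theorems only (no definitions, no named facts). Sequel
of `PositiveKernelOperator.lean` (the integral operator `S` of a bounded continuous kernel `G` on
`L²(ν)`, `ν` a finite Borel measure on `ℝ`, and its compactness).

For `G` moreover symmetric (`G(x, y) = G(y, x)`) and strictly positive and `ν ≠ 0`: `S` is
symmetric (Fubini), nonzero, and `|⟪S g, g⟫| ≤ ⟪S |g|, |g|⟫`. Consequently (Jentzsch 1912;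
Reed–Simon IV, Thms XIII.43–44, "positivity improving"; the argument of Glimm–Jaffe Thm 3.3.2, run
here through `T = S²`, which is positive, and the tree's `exists_eigenvector_norm` /
`eq_smul_of_rayleigh_eq_norm` of `GroundStateFeynmanKacSpectral`): the top of the spectrum
`‖S‖ > 0` is an eigenvalue with a nonnegative unit eigenvector `φ`, and
`ψ = ‖S‖⁻¹ ∫ G(·, y) φ(y) dν(y)` is a version of `φ` which is continuous, bounded, EVERYWHERE
strictly positive, normalised (`∫ ψ² dν = 1`), and satisfies the eigen-equation
`∫ G(x, y) ψ(y) dν(y) = ‖S‖ ψ(x)` at every point.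

Main result: `exists_pos_eigenfunction_of_pos_kernel`. This is the transfer-operator input for
one-dimensional unbounded-spin systems (a priori measure `ν = e^{-U/T} dq` of a pinned chain,
kernel `G(q, q') = e^{-V(q' - q)/T}`): the positive eigenfunction defines the stationary Markov
chain which is an infinite-volume Gibbs measure (Cassandro–Olivieri–Pellegrinotti–Presutti 1978).

* `inner_kernelOp_comm`, `abs_inner_kernelOp_le`, `kernelOp_ne_zero`;
* `exists_nonneg_eigenvector_of_abs_inner_le` — abstract: a nonzero compact symmetric operator
  on `L²(ν)` with `|⟪S g, g⟫| ≤ ⟪S |g|, |g|⟫` has the eigenvalue `‖S‖ > 0` with a nonnegative unit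
  eigenvector;
* `exists_nonneg_eigenvector_kernelOp`, `exists_pos_eigenfunction_of_pos_kernel`.

## References

* R. Jentzsch, *Über Integralgleichungen mit positivem Kern*, J. reine angew. Math. 141 (1912).
* M. Reed, B. Simon, *Methods of Modern Mathematical Physics IV* (1978), Thms XIII.43–XIII.44.
  [ReedSimonIV1978]
* M. Cassandro, E. Olivieri, A. Pellegrinotti, E. Presutti, Z. Wahrsch. verw. Gebiete 41 (1978)
  313–334, §2 (transfer operator of one-dimensional unbounded spin systems).
-/

noncomputable section

open MeasureTheory Filter Set Metric Function
open scoped ENNReal NNReal Topology InnerProductSpace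

namespace Literature.Analysis.FunctionSpaces

variable {ν : Measure ℝ}

/-! ### Symmetry, positivity improvement, non-triviality of the integral operator -/

section KernelOp

variable [IsFiniteMeasure ν] {G : ℝ → ℝ → ℝ} {B : ℝ} {κ : ℝ → Lp ℝ 2 ν}

/-- **Symmetry**: for a symmetric kernel the integral operator is symmetric,
`⟪S g, h⟫ = ⟪g, S h⟫` (Fubini). [folklore] -/
theorem inner_kernelOp_comm (hG : Continuous (uncurry G)) (hB : ∀ x y, |G x y| ≤ B)
    (hsymm : ∀ x y, G x y = G y x) (hκ : ∀ x, (κ x : ℝ → ℝ) =ᵐ[ν] fun y => G x y)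
    {S : Lp ℝ 2 ν →L[ℝ] Lp ℝ 2 ν} (hS : ∀ g : Lp ℝ 2 ν, (S g : ℝ → ℝ) =ᵐ[ν] fun x => ⟪κ x, g⟫_ℝ)
    (g h : Lp ℝ 2 ν) : ⟪S g, h⟫_ℝ = ⟪g, S h⟫_ℝ := by
  rw [real_inner_comm (S h) g, inner_kernelOp_eq hκ hS, inner_kernelOp_eq hκ hS]
  calc ∫ x, (∫ y, G x y * g y ∂ν) * h x ∂ν = ∫ x, ∫ y, G x y * g y * h x ∂ν ∂ν := by
        refine integral_congr_ae (Eventually.of_forall fun x => ?_)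
        exact (integral_mul_const ((h : ℝ → ℝ) x) _).symm
    _ = ∫ y, ∫ x, G x y * g y * h x ∂ν ∂ν :=
        integral_integral_swap (integrable_kernel_mul_mul hG hB g h)
    _ = ∫ y, (∫ x, G y x * h x ∂ν) * g y ∂ν := by
        refine integral_congr_ae (Eventually.of_forall fun y => ?_)
        dsimp only
        rw [← integral_mul_const]
        refine integral_congr_ae (Eventually.of_forall fun x => ?_)
        dsimp only
        rw [hsymm x y]; ring

/-- **`|⟪S g, g⟫| ≤ ⟪S |g|, |g|⟫`** for a nonnegative kernel. [folklore] -/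
theorem abs_inner_kernelOp_le (hG : Continuous (uncurry G)) (hB : ∀ x y, |G x y| ≤ B)
    (hGnn : ∀ x y, 0 ≤ G x y) (hκ : ∀ x, (κ x : ℝ → ℝ) =ᵐ[ν] fun y => G x y)
    {S : Lp ℝ 2 ν →L[ℝ] Lp ℝ 2 ν} (hS : ∀ g : Lp ℝ 2 ν, (S g : ℝ → ℝ) =ᵐ[ν] fun x => ⟪κ x, g⟫_ℝ)
    (g : Lp ℝ 2 ν) : |⟪S g, g⟫_ℝ| ≤ ⟪S |g|, |g|⟫_ℝ := by
  rw [inner_kernelOp_eq hκ hS, inner_kernelOp_eq hκ hS]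
  have hR : ∫ x, (∫ y, G x y * (|g| : Lp ℝ 2 ν) y ∂ν) * (|g| : Lp ℝ 2 ν) x ∂ν =
      ∫ x, (∫ y, G x y * |g y| ∂ν) * |g x| ∂ν := by
    refine integral_congr_ae ?_
    filter_upwards [Lp.coeFn_abs g] with x hx
    rw [hx]
    congr 1
    refine integral_congr_ae ?_
    filter_upwards [Lp.coeFn_abs g] with y hy
    rw [hy]
  rw [hR]
  -- integrability of the majorant
  have hb0 : 0 ≤ B := (abs_nonneg _).trans (hB 0 0)
  have hinner_bd : ∀ x, |(∫ y, G x y * |g y| ∂ν)| ≤ B * ∫ y, |(g : ℝ → ℝ) y| ∂ν := by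
    intro x
    calc |(∫ y, G x y * |g y| ∂ν)| ≤ ∫ y, |(G x y * |g y|)| ∂ν := abs_integral_le_integral_abs
      _ ≤ ∫ y, B * |(g : ℝ → ℝ) y| ∂ν := by
          refine integral_mono_of_nonneg (Eventually.of_forall fun y => abs_nonneg _)
            ((integrable_coeFn_Lp_two g).abs.const_mul B) (Eventually.of_forall fun y => ?_)
          dsimp only
          rw [abs_mul, abs_abs]
          exact mul_le_mul_of_nonneg_right (hB x y) (abs_nonneg _)
      _ = B * ∫ y, |(g : ℝ → ℝ) y| ∂ν := integral_const_mul _ _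
  have hinner_cont : Continuous fun x => ∫ y, G x y * |g y| ∂ν := by
    refine continuous_of_dominated (bound := fun y => B * |(g : ℝ → ℝ) y|) (fun x => ?_)
      (fun x => Eventually.of_forall fun y => ?_) ((integrable_coeFn_Lp_two g).abs.const_mul B)
      (Eventually.of_forall fun y => ?_)
    · exact (hG.uncurry_left x).aestronglyMeasurable.mul
        (integrable_coeFn_Lp_two g).abs.aestronglyMeasurable
    · rw [Real.norm_eq_abs, abs_mul, abs_abs]
      exact mul_le_mul_of_nonneg_right (hB x y) (abs_nonneg _)
    · exact (hG.uncurry_right y).mul continuous_const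
  have hmaj : Integrable (fun x => (∫ y, G x y * |g y| ∂ν) * |g x|) ν := by
    refine (integrable_coeFn_Lp_two g).abs.bdd_mul hinner_cont.aestronglyMeasurable
      (c := B * ∫ y, |(g : ℝ → ℝ) y| ∂ν) (Eventually.of_forall fun x => ?_)
    rw [Real.norm_eq_abs]; exact hinner_bd x
  calc |∫ x, (∫ y, G x y * g y ∂ν) * g x ∂ν| ≤ ∫ x, |(∫ y, G x y * g y ∂ν) * g x| ∂ν :=
        abs_integral_le_integral_abs
    _ ≤ ∫ x, (∫ y, G x y * |g y| ∂ν) * |g x| ∂ν := by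
        refine integral_mono_of_nonneg (Eventually.of_forall fun x => abs_nonneg _) hmaj
          (Eventually.of_forall fun x => ?_)
        dsimp only
        rw [abs_mul]
        refine mul_le_mul_of_nonneg_right ?_ (abs_nonneg _)
        calc |∫ y, G x y * g y ∂ν| ≤ ∫ y, |G x y * g y| ∂ν := abs_integral_le_integral_abs
          _ = ∫ y, G x y * |g y| ∂ν := by
              refine integral_congr_ae (Eventually.of_forall fun y => ?_)
              dsimp only
              rw [abs_mul, abs_of_nonneg (hGnn x y)]

/-- **The integral operator of a strictly positive kernel is nonzero** (`ν ≠ 0`): it maps the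
constant `1` to the everywhere positive function `x ↦ ∫ G(x, y) dν(y)`. [folklore] -/
theorem kernelOp_ne_zero (hν : ν ≠ 0) (hpos : ∀ x y, 0 < G x y) (hG : Continuous (uncurry G))
    (hB : ∀ x y, |G x y| ≤ B) (hκ : ∀ x, (κ x : ℝ → ℝ) =ᵐ[ν] fun y => G x y)
    {S : Lp ℝ 2 ν →L[ℝ] Lp ℝ 2 ν} (hS : ∀ g : Lp ℝ 2 ν, (S g : ℝ → ℝ) =ᵐ[ν] fun x => ⟪κ x, g⟫_ℝ) :
    S ≠ 0 := by
  intro h0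
  set one : Lp ℝ 2 ν := indicatorConstLp 2 MeasurableSet.univ (measure_ne_top ν _) (1 : ℝ)
  have h1 : (one : ℝ → ℝ) =ᵐ[ν] fun _ => 1 := by
    filter_upwards [indicatorConstLp_coeFn (p := 2) (hs := MeasurableSet.univ)
      (hμs := measure_ne_top ν _) (c := (1 : ℝ))] with x hx
    rw [hx, indicator_of_mem (mem_univ x)]
  -- `(S 1)(x) = ∫ G(x, y) dν(y) > 0` a.e., but `S = 0`
  have hI : ∀ x, 0 < ∫ y, G x y ∂ν := by
    intro x
    have hint : Integrable (fun y => G x y) ν :=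
      (memLp_kernel_row hG hB x).integrable (by norm_num)
    rw [integral_pos_iff_support_of_nonneg (fun y => (hpos x y).le) hint]
    have hsupp : support (fun y => G x y) = univ :=
      eq_univ_of_forall fun y => (hpos x y).ne'
    rw [hsupp]
    exact Measure.measure_univ_pos.2 hν
  have hae : ∀ᵐ x ∂ν, False := by
    have hz : ((S one : Lp ℝ 2 ν) : ℝ → ℝ) =ᵐ[ν] 0 := by
      rw [h0, zero_apply]
      exact Lp.coeFn_zero _ _ _
    filter_upwards [hz, hS one] with x hx hx'
    rw [hx', inner_kernelVec_eq_integral hκ] at hx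
    have h2 : ∫ y, G x y * (one : ℝ → ℝ) y ∂ν = ∫ y, G x y ∂ν := by
      refine integral_congr_ae ?_
      filter_upwards [h1] with y hy
      rw [hy, mul_one]
    rw [h2] at hx
    exact (hI x).ne' hx
  exact hν (ae_eq_bot.1 (eventually_false_iff_eq_bot.1 hae))

end KernelOp

/-! ### The top eigenvalue and a nonnegative eigenvector -/

section Eigen

variable [IsFiniteMeasure ν]

omit [IsFiniteMeasure ν] in
open Literature.MathematicalPhysics.QuantumManyBody.BoseGas in
/-- **A nonzero compact symmetric operator on `L²(ν)` with `|⟪S g, g⟫| ≤ ⟪S |g|, |g|⟫` has the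
eigenvalue `‖S‖ > 0` with a nonnegative unit eigenvector.** Proof: `T = S²` is compact, positive
and symmetric, so (`exists_eigenvector_norm`) it has a unit eigenvector `e` for `‖T‖ = ‖S‖²`
(`‖S x‖² = ⟪T x, x⟫ ≤ ‖T‖ ‖x‖²` and `‖T‖ ≤ ‖S‖²`); then `S e + ‖S‖ e`, or `e` itself if that
vanishes, is an eigenvector `φ₀` of `S` for `±‖S‖`, and `|φ₀| / ‖φ₀‖` maximises the Rayleigh quotient
(`‖S‖ = |⟪S φ₀, φ₀⟫| / ‖φ₀‖² ≤ ⟪S |φ₀|, |φ₀|⟫ / ‖φ₀‖²`), hence is an eigenvector for `‖S‖`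
(`eq_smul_of_rayleigh_eq_norm`) (Reed–Simon IV, proof of Thm XIII.44; Glimm–Jaffe Thm 3.3.2).
[cite: ReedSimonIV1978, Thm XIII.44] -/
theorem exists_nonneg_eigenvector_of_abs_inner_le {S : Lp ℝ 2 ν →L[ℝ] Lp ℝ 2 ν}
    (hsym : ∀ g h : Lp ℝ 2 ν, ⟪S g, h⟫_ℝ = ⟪g, S h⟫_ℝ)
    (habs : ∀ g : Lp ℝ 2 ν, |⟪S g, g⟫_ℝ| ≤ ⟪S |g|, |g|⟫_ℝ) (hc : IsCompactOperator S)
    (hS0 : S ≠ 0) :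
    0 < ‖S‖ ∧ ∃ φ : Lp ℝ 2 ν, ‖φ‖ = 1 ∧ (0 ≤ᵐ[ν] (φ : ℝ → ℝ)) ∧ S φ = ‖S‖ • φ := by
  set T : Lp ℝ 2 ν →L[ℝ] Lp ℝ 2 ν := S.comp S with hTdef
  have hTapp : ∀ x, T x = S (S x) := fun x => rfl
  have hTsym : ∀ x y, ⟪T x, y⟫_ℝ = ⟪x, T y⟫_ℝ := by
    intro x y; rw [hTapp, hTapp, hsym, hsym]
  have hTxx : ∀ x, ⟪T x, x⟫_ℝ = ‖S x‖ ^ 2 := by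
    intro x; rw [hTapp, hsym, real_inner_self_eq_norm_sq]
  have hTpos : ∀ x, 0 ≤ ⟪T x, x⟫_ℝ := fun x => by rw [hTxx]; positivity
  have hTc : IsCompactOperator T := hc.clm_comp S
  have hT0 : T ≠ 0 := by
    intro hT
    apply hS0
    ext1 x
    have h : ‖S x‖ ^ 2 = 0 := by rw [← hTxx, hT]; simp
    simpa using h
  obtain ⟨e, he1, hTe⟩ := exists_eigenvector_norm T hTsym hTpos hTc hT0
  have hTn : 0 < ‖T‖ := norm_pos_iff.2 hT0
  set r : ℝ := Real.sqrt ‖T‖ with hrdef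
  have hr : 0 < r := Real.sqrt_pos.2 hTn
  have hr2 : r * r = ‖T‖ := Real.mul_self_sqrt (norm_nonneg _)
  -- `‖S‖ = r`
  have hSle : ∀ x, ‖S x‖ ≤ r * ‖x‖ := by
    intro x
    have h1 : ‖S x‖ ^ 2 ≤ (r * ‖x‖) ^ 2 := by
      rw [← hTxx, mul_pow, sq r, hr2]
      calc ⟪T x, x⟫_ℝ ≤ ‖T x‖ * ‖x‖ := real_inner_le_norm _ _
        _ ≤ ‖T‖ * ‖x‖ * ‖x‖ := mul_le_mul_of_nonneg_right (T.le_opNorm x) (norm_nonneg _)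
        _ = ‖T‖ * ‖x‖ ^ 2 := by ring
    exact (pow_le_pow_iff_left₀ (norm_nonneg _) (by positivity) two_ne_zero).1 h1
  have hSr : ‖S‖ = r := by
    refine le_antisymm (ContinuousLinearMap.opNorm_le_bound _ hr.le hSle) ?_
    calc r = Real.sqrt ‖T‖ := rfl
      _ ≤ Real.sqrt (‖S‖ * ‖S‖) := Real.sqrt_le_sqrt (ContinuousLinearMap.opNorm_comp_le S S)
      _ = ‖S‖ := Real.sqrt_mul_self (norm_nonneg _)
  -- an eigenvector `φ₀` of `S` for `±r`, with `r ‖φ₀‖² ≤ |⟪S φ₀, φ₀⟫|`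
  set f : Lp ℝ 2 ν := S e + r • e with hfdef
  have hSf : S f = r • f := by
    have hSSe : S (S e) = (r * r) • e := by rw [← hTapp, hTe, hr2]
    simp only [hfdef, map_add, map_smul, hSSe, smul_add, smul_smul]
    rw [add_comm]
  obtain ⟨φ₀, hφ₀, hRay⟩ : ∃ φ₀ : Lp ℝ 2 ν, φ₀ ≠ 0 ∧ r * ‖φ₀‖ ^ 2 ≤ |⟪S φ₀, φ₀⟫_ℝ| := by
    by_cases hf : f = 0
    · refine ⟨e, fun he0 => by simp [he0] at he1, ?_⟩
      have hSe : S e = (-r) • e := by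
        have h := hf
        rw [hfdef, add_eq_zero_iff_eq_neg] at h
        rw [h, neg_smul]
      rw [hSe, inner_smul_left, real_inner_self_eq_norm_sq, he1]
      simp [abs_of_pos hr]
    · refine ⟨f, hf, ?_⟩
      rw [hSf, inner_smul_left, real_inner_self_eq_norm_sq]
      simp only [conj_trivial]
      rw [abs_of_nonneg (by positivity)]
  -- the nonnegative maximiser `φ₁ = |φ₀| / ‖φ₀‖`
  have hn0 : 0 < ‖φ₀‖ := norm_pos_iff.2 hφ₀
  have hna : ‖(|φ₀| : Lp ℝ 2 ν)‖ = ‖φ₀‖ := norm_abs_eq_norm φ₀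
  set φ₁ : Lp ℝ 2 ν := ‖φ₀‖⁻¹ • |φ₀| with hφ₁def
  have hφ₁1 : ‖φ₁‖ = 1 := by
    rw [hφ₁def, norm_smul, norm_inv, norm_norm, hna, inv_mul_cancel₀ hn0.ne']
  have hray1 : ⟪S φ₁, φ₁⟫_ℝ = ‖S‖ := by
    refine le_antisymm (rayleigh_le_opNorm S hφ₁1) ?_
    have h2 := (hRay.trans (habs φ₀))
    rw [hφ₁def, map_smul, inner_smul_left, inner_smul_right]
    simp only [conj_trivial]
    rw [hSr]
    have : r = ‖φ₀‖⁻¹ * (‖φ₀‖⁻¹ * (r * ‖φ₀‖ ^ 2)) := by field_simp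
    rw [this]
    gcongr
  have heig := eq_smul_of_rayleigh_eq_norm S hφ₁1 hray1
  refine ⟨hSr ▸ hr, φ₁, hφ₁1, ?_, heig⟩
  -- nonnegativity of `φ₁` almost everywhere
  filter_upwards [Lp.coeFn_smul ‖φ₀‖⁻¹ (|φ₀| : Lp ℝ 2 ν), Lp.coeFn_abs φ₀] with x hx habsx
  simp only [hφ₁def]
  rw [hx, Pi.smul_apply, habsx, smul_eq_mul]
  exact mul_nonneg (inv_nonneg.2 (norm_nonneg _)) (abs_nonneg _)

variable {G : ℝ → ℝ → ℝ} {B : ℝ} {κ : ℝ → Lp ℝ 2 ν}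

/-- **The integral operator of a positive symmetric continuous kernel has the eigenvalue `‖S‖ > 0`
with a nonnegative unit eigenvector** (Jentzsch; Reed–Simon IV Thm XIII.43). [cite: ReedSimonIV1978, Thm XIII.44] -/
theorem exists_nonneg_eigenvector_kernelOp (hν : ν ≠ 0) (hG : Continuous (uncurry G))
    (hB : ∀ x y, |G x y| ≤ B) (hsymm : ∀ x y, G x y = G y x) (hpos : ∀ x y, 0 < G x y)
    (hκ : ∀ x, (κ x : ℝ → ℝ) =ᵐ[ν] fun y => G x y) {S : Lp ℝ 2 ν →L[ℝ] Lp ℝ 2 ν}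
    (hS : ∀ g : Lp ℝ 2 ν, (S g : ℝ → ℝ) =ᵐ[ν] fun x => ⟪κ x, g⟫_ℝ) :
    0 < ‖S‖ ∧ ∃ φ : Lp ℝ 2 ν, ‖φ‖ = 1 ∧ (0 ≤ᵐ[ν] (φ : ℝ → ℝ)) ∧ S φ = ‖S‖ • φ :=
  exists_nonneg_eigenvector_of_abs_inner_le (inner_kernelOp_comm hG hB hsymm hκ hS)
    (abs_inner_kernelOp_le hG hB (fun x y => (hpos x y).le) hκ hS)
    (isCompactOperator_kernelOp hG hB hκ hS) (kernelOp_ne_zero hν hpos hG hB hκ hS)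

/-! ### The everywhere positive continuous eigenfunction -/

/-- **Jentzsch's theorem for continuous positive symmetric kernels (existence part).** Let `ν ≠ 0`
be a finite Borel measure on `ℝ` and `G` a continuous, bounded, symmetric, strictly positive
kernel. Then there are `λ > 0` (namely `λ = ‖S‖`, the norm of the integral operator on `L²(ν)`)
and a function `ψ : ℝ → ℝ` which is continuous, bounded, strictly positive everywhere, normalised
by `∫ ψ² dν = 1`, and satisfies the eigen-equation `∫ G(x, y) ψ(y) dν(y) = λ ψ(x)` at EVERY
point `x`. (`ψ = λ⁻¹ ∫ G(·, y) φ(y) dν(y)` for the nonnegative `L²` eigenvector `φ` of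
`exists_nonneg_eigenvector_kernelOp`; positivity improving: `G > 0` and `φ ≥ 0`, `φ ≠ 0`.)
Reed–Simon IV, Thms XIII.43–XIII.44; for transfer operators of one-dimensional unbounded spin
systems, Cassandro–Olivieri–Pellegrinotti–Presutti (1978), §2. [cite: ReedSimonIV1978, Thm XIII.43] -/
theorem exists_pos_eigenfunction_of_pos_kernel (ν : Measure ℝ) [IsFiniteMeasure ν] (hν : ν ≠ 0)
    {G : ℝ → ℝ → ℝ} (hG : Continuous (uncurry G)) (hsymm : ∀ x y, G x y = G y x)
    (hpos : ∀ x y, 0 < G x y) {B : ℝ} (hB : ∀ x y, G x y ≤ B) :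
    ∃ (lam : ℝ) (ψ : ℝ → ℝ), 0 < lam ∧ Continuous ψ ∧ (∀ x, 0 < ψ x) ∧ (∃ C, ∀ x, ψ x ≤ C) ∧
      Integrable (fun x => ψ x ^ 2) ν ∧ ∫ x, ψ x ^ 2 ∂ν = 1 ∧
      (∀ x, Integrable (fun y => G x y * ψ y) ν) ∧ ∀ x, ∫ y, G x y * ψ y ∂ν = lam * ψ x := by
  have hB' : ∀ x y, |G x y| ≤ B := fun x y => by rw [abs_of_pos (hpos x y)]; exact hB x y
  have hb0 : 0 ≤ B := (abs_nonneg _).trans (hB' 0 0)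
  obtain ⟨κ, hκ⟩ := exists_kernelVec (ν := ν) hG hB'
  obtain ⟨S, hS⟩ := exists_kernelOp hG hB' hκ
  obtain ⟨hlam, φ, hφ1, hφ0, hSφ⟩ := exists_nonneg_eigenvector_kernelOp hν hG hB' hsymm hpos hκ hS
  set lam : ℝ := ‖S‖ with hlamdef
  -- the `L²` eigenvector as a function, and the candidate `ψ`
  have hφi : Integrable (φ : ℝ → ℝ) ν := integrable_coeFn_Lp_two φ
  set I : ℝ → ℝ := fun x => ∫ y, G x y * φ y ∂ν with hIdef
  set ψ : ℝ → ℝ := fun x => lam⁻¹ * I x with hψdef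
  -- `φ = ψ` a.e. (the eigen-equation in `L²`)
  have hφψ : (φ : ℝ → ℝ) =ᵐ[ν] ψ := by
    have h1 : ((S φ : Lp ℝ 2 ν) : ℝ → ℝ) =ᵐ[ν] fun x => lam * φ x := by
      rw [hSφ]
      filter_upwards [Lp.coeFn_smul ‖S‖ φ] with x hx
      rw [hx, Pi.smul_apply, smul_eq_mul]
    filter_upwards [h1, hS φ] with x hx hx'
    rw [hx', inner_kernelVec_eq_integral hκ] at hx
    simp only [hψdef, hIdef]
    rw [hx, ← mul_assoc, inv_mul_cancel₀ hlam.ne', one_mul]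
  -- continuity and bounds of `I`
  have hIcont : Continuous I := by
    refine continuous_of_dominated (bound := fun y => B * |(φ : ℝ → ℝ) y|) (fun x => ?_)
      (fun x => Eventually.of_forall fun y => ?_) (hφi.abs.const_mul B)
      (Eventually.of_forall fun y => ?_)
    · exact (hG.uncurry_left x).aestronglyMeasurable.mul hφi.aestronglyMeasurable
    · rw [Real.norm_eq_abs, abs_mul]
      exact mul_le_mul_of_nonneg_right (hB' x y) (abs_nonneg _)
    · exact (hG.uncurry_right y).mul continuous_const
  have hIbd : ∀ x, |I x| ≤ B * ∫ y, |(φ : ℝ → ℝ) y| ∂ν := by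
    intro x
    calc |I x| ≤ ∫ y, |(G x y * φ y)| ∂ν := abs_integral_le_integral_abs
      _ ≤ ∫ y, B * |(φ : ℝ → ℝ) y| ∂ν := by
          refine integral_mono_of_nonneg (Eventually.of_forall fun y => abs_nonneg _)
            (hφi.abs.const_mul B) (Eventually.of_forall fun y => ?_)
          dsimp only
          rw [abs_mul]
          exact mul_le_mul_of_nonneg_right (hB' x y) (abs_nonneg _)
      _ = B * ∫ y, |(φ : ℝ → ℝ) y| ∂ν := integral_const_mul _ _
  -- strict positivity of `I`: `φ ≥ 0` is not a.e. zero
  have hsupp : 0 < ν (support (φ : ℝ → ℝ)) := by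
    rw [pos_iff_ne_zero]
    intro h0
    have hae : (φ : ℝ → ℝ) =ᵐ[ν] 0 := by
      have : ∀ᵐ x ∂ν, x ∉ support (φ : ℝ → ℝ) := measure_eq_zero_iff_ae_notMem.1 h0
      filter_upwards [this] with x hx
      simpa [mem_support] using hx
    have hφ0' : φ = 0 := Lp.eq_zero_iff_ae_eq_zero.2 hae
    rw [hφ0', norm_zero] at hφ1
    exact zero_ne_one hφ1
  have hIpos : ∀ x, 0 < I x := by
    intro x
    have hint : Integrable (fun y => G x y * φ y) ν :=
      hφi.bdd_mul (hG.uncurry_left x).aestronglyMeasurable (c := B)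
        (Eventually.of_forall fun y => by rw [Real.norm_eq_abs]; exact hB' x y)
    have hnn : 0 ≤ᵐ[ν] fun y => G x y * φ y := by
      filter_upwards [hφ0] with y hy
      exact mul_nonneg (hpos x y).le hy
    simp only [hIdef]
    rw [integral_pos_iff_support_of_nonneg_ae hnn hint]
    have hs : support (fun y => G x y * φ y) = support (φ : ℝ → ℝ) := by
      ext y
      simp only [mem_support, ne_eq, mul_eq_zero, (hpos x y).ne', false_or]
    rwa [hs]
  -- conclusion
  refine ⟨lam, ψ, hlam, ?_, ?_, ?_, ?_, ?_, ?_, ?_⟩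
  · exact continuous_const.mul hIcont
  · intro x
    exact mul_pos (inv_pos.2 hlam) (hIpos x)
  · refine ⟨lam⁻¹ * (B * ∫ y, |(φ : ℝ → ℝ) y| ∂ν), fun x => ?_⟩
    exact mul_le_mul_of_nonneg_left ((le_abs_self _).trans (hIbd x)) (inv_pos.2 hlam).le
  · exact (Lp.memLp φ).integrable_sq.congr (hφψ.mono fun x hx => by simp [hx])
  · have h : ∫ x, ψ x ^ 2 ∂ν = ∫ x, (φ : ℝ → ℝ) x ^ 2 ∂ν :=
      integral_congr_ae (hφψ.mono fun x hx => by simp [hx])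
    rw [h, ← norm_Lp_sq_eq_integral, hφ1, one_pow]
  · intro x
    have hψb : ∀ y, ‖ψ y‖ ≤ lam⁻¹ * (B * ∫ y, |(φ : ℝ → ℝ) y| ∂ν) := by
      intro y
      rw [Real.norm_eq_abs, hψdef]
      dsimp only
      rw [abs_mul, abs_of_pos (inv_pos.2 hlam)]
      exact mul_le_mul_of_nonneg_left (hIbd y) (inv_pos.2 hlam).le
    refine (integrable_const (lam⁻¹ * (B * ∫ y, |(φ : ℝ → ℝ) y| ∂ν) * B)).mono'
      ((hG.uncurry_left x).mul (continuous_const.mul hIcont)).aestronglyMeasurable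
      (Eventually.of_forall fun y => ?_)
    rw [norm_mul, Real.norm_eq_abs, mul_comm]
    exact mul_le_mul (hψb y) (hB' x y) (abs_nonneg _) (by positivity)
  · intro x
    have h : ∫ y, G x y * ψ y ∂ν = I x := by
      simp only [hIdef]
      refine integral_congr_ae ?_
      filter_upwards [hφψ] with y hy
      rw [hy]
    rw [h, hψdef]
    dsimp only
    rw [← mul_assoc, mul_inv_cancel₀ hlam.ne', one_mul]

end Eigen

end Literature.Analysis.FunctionSpaces
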